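import Summits.ABC.ABC.Theses.CubicResolventAllowance
import Summits.ABC.ABC.Theorems.TwoTorsionDictionary
import Summits.ABC.ABC.Theorems.CubicResolventAllowanceResolventDiscBoundsCaps
import Literature.NumberTheory.NumberFields.IntegralBasisOfFamily
import Literature.NumberTheory.EllipticCurves.QuadraticTwist
import Literature.NumberTheory.EllipticCurves.SzpiroOfAbcProofs

/-!
# Stub ideation k=3, generation 2 (family 3: probe the extremes) — `stub_realCubic` of crux
`IndexSzpiro` (stmt-ABC-22740), route `CubicResolventAllowance`.

Companion to `STUB-IDEAS-stub_realCubic-3.md` (gen 2).  Everything marked `sorry` is a PROPOSED helper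
lemma whose signature is checked to elaborate over existing declarations; the `sorry`-free theorems are
the (cheap) glue showing how the helpers recombine into the registered stub.  Nothing here claims the stub.

New in gen 2 (relative to the gen-0 sketch `StubIdeas3Sketch.lean`, namespace `…StubIdeas3`):
* `exists_index_sq_eq` (**N1★**, the master identity `2⁸·Δ_min = I²·|d_K|`, `I` = index of the order
  generated by `4·x(P)`, `P ∈ E[2]`, on a global minimal model) — it implies gen-0's H0/H1′/H2/H3 and the
  divisibilities `|d_K| ∣ 2⁸ Δ_min`, `|d_K| ∣ 8 Δ_min` (N1a/N1b) by arithmetic;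
* `IndexBound` and the PROVED equivalence `StubRealCubic ↔ IndexBound` (the stub is literally
  "index-Szpiro": `I² ≤ C · N^{6+ε}` on the real class);
* the universal plane-cubic family `curveOf α` (`α ∈ 𝓞 K`) with its dictionary Dα1–Dα5
  (2-division polynomial, discriminant = `16 · det² · d_K` via `discr_family_eq_det_sq_mul_discr`,
  multiplicativity of odd unramified index primes for primitive `α`, universality, primitive reduction =
  quadratic twist);
* `FixedFieldIndexSzpiro K` (the one-field slice, constant allowed to depend on `K`) with the trivial
  glue from the stub — recorded to state honestly that even this slice is open (certificate jobs
  j344421 / j344431: Szpiro ratios up to 7.45 inside `d_K = 564, 568`);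
* two exact LOCAL LAWS found by the family-3 scans and stated as conjectured helpers (certificates
  j344444 / j344476 / j344484, zero failures): **N1♯** `|d_K| ∣ 4·Δ_min` ("wild at 2 ⇒ bad at 2") and
  **L♮** `|d_K| ∣ 4·N` (odd part of `d_K` divides `N`; versus the landed `|d_K| ∣ 1944·N²`).
`lean check`: rc 0; `sorry` exactly in the 10 proposed helpers; N1a/N1b/N1c, the stub ↔ IndexBound
equivalence and the fixed-field glue are proved.
-/

set_option linter.dupNamespace false

noncomputable section

namespace Summit.ABC.ABC.Cruxes.IndexSzpiro.StubIdeas3G2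

open NumberField Polynomial
open Summit.ABC.ABC.Theses.CubicResolventAllowance

/-! ## The registered stub, verbatim -/

/-- `stub_realCubic` (the `d_K > 0` half of `IndexSzpiro`), verbatim registered signature
(identical to `StubIdeas3.StubRealCubic` of the gen-0 sketch). -/
def StubRealCubic : Prop :=
  ∀ ε : ℝ, 0 < ε → ∃ C : ℝ, ∀ (W : WeierstrassCurve ℚ) [W.IsElliptic] (K : Type) [Field K]
    [NumberField K], Irreducible W.twoTorsionPolynomial.toPoly → Module.finrank ℚ K = 3 →
    (∃ θ : K, Polynomial.aeval θ W.twoTorsionPolynomial.toPoly = 0) → 0 < NumberField.discr K →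
    (W.minimalDiscriminantNorm ℤ : ℝ) ≤
      C * |(NumberField.discr K : ℝ)| * (W.conductorNorm ℤ : ℝ) ^ (6 + ε)

/-! ## N1★ — the master identity `2⁸ Δ_min = I² |d_K|` and its arithmetic corollaries -/

section Identity

variable (W : WeierstrassCurve ℚ) [W.IsElliptic] (K : Type) [Field K] [NumberField K]

/-- **N1★ (index identity).** For a global minimal model `W_min` (`exists_baseChange_int_forall_isMinimalAt`)
and `P = (x, y) ∈ E[2](K̄)`, `θ' = 4x` is a root of the monic integral cubic
`g(t) = t³ + b₂ t² + 8 b₄ t + 16 b₆ = 16·ψ₂(t/4)`, so `θ' ∈ 𝓞_K`, `K = ℚ(θ')` and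
`disc g = 4⁶ · (Δ/16) = 2⁸ Δ(W_min)` (Mathlib `WeierstrassCurve.twoTorsionPolynomial_discr`:
`disc ψ₂ = 16 Δ`), while `disc g = [𝓞_K : ℤ[θ']]² · d_K` (`discr_family_eq_det_sq_mul_discr` /
`Algebra.discr_powerBasis_eq_prod''`).  With `|Δ(W_min)| = Δ_min`
(`minimalDiscriminantNorm_eq_natAbs_holds`) this is `2⁸ Δ_min = I² |d_K|`.  One–two prover cycles. -/
theorem exists_index_sq_eq (hirr : Irreducible W.twoTorsionPolynomial.toPoly)
    (hdeg : Module.finrank ℚ K = 3)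
    (hθ : ∃ θ : K, Polynomial.aeval θ W.twoTorsionPolynomial.toPoly = 0) :
    ∃ I : ℕ, 0 < I ∧ 2 ^ 8 * W.minimalDiscriminantNorm ℤ = I ^ 2 * (NumberField.discr K).natAbs := by
  sorry

/-- **N1a** `|d_K| ∣ 2⁸ · Δ_min` (from N1★; certificate: 0 failures / 3.95·10⁶ curves). -/
theorem natAbs_discr_dvd_two_pow_mul (hirr : Irreducible W.twoTorsionPolynomial.toPoly)
    (hdeg : Module.finrank ℚ K = 3)
    (hθ : ∃ θ : K, Polynomial.aeval θ W.twoTorsionPolynomial.toPoly = 0) :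
    (NumberField.discr K).natAbs ∣ 2 ^ 8 * W.minimalDiscriminantNorm ℤ := by
  obtain ⟨I, -, hI⟩ := exists_index_sq_eq W K hirr hdeg hθ
  exact ⟨I ^ 2, by rw [hI, mul_comm]⟩

/-- **N1b** the sharp form at `2`: `|d_K| ∣ 8 · Δ_min` (N1a for odd `p`; at `2` the cap `v₂(d_K) ≤ 3`,
`padicValNat_two_discr_le_three`).  Sharp: `d_K = -44`, `E = 11a1` has `v₂(d_K) = 2`, `v₂(Δ_min) = 0`;
fields with `v₂(d_K) = 3` and `2 ∤ Δ_min` occur in job j344431 (`Δ_min < |d_K|`).  Certificate: 0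
failures / 3.95·10⁶ curves. -/
theorem natAbs_discr_dvd_eight_mul (hirr : Irreducible W.twoTorsionPolynomial.toPoly)
    (hdeg : Module.finrank ℚ K = 3)
    (hθ : ∃ θ : K, Polynomial.aeval θ W.twoTorsionPolynomial.toPoly = 0) :
    (NumberField.discr K).natAbs ∣ 8 * W.minimalDiscriminantNorm ℤ := by
  have hdvd := natAbs_discr_dvd_two_pow_mul W K hirr hdeg hθ
  have hcap : (NumberField.discr K).natAbs.factorization 2 ≤ 3 := by
    rw [Nat.factorization_def _ Nat.prime_two]
    exact Summit.ABC.ABC.Theorems.padicValNat_two_discr_le_three K hdeg.le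
  have hd0 : (NumberField.discr K).natAbs ≠ 0 := Int.natAbs_ne_zero.mpr (NumberField.discr_ne_zero K)
  have hm0 : W.minimalDiscriminantNorm ℤ ≠ 0 := (W.minimalDiscriminantNorm_pos_holds).ne'
  have h1 := (Nat.factorization_prime_le_iff_dvd hd0 (by positivity)).mpr hdvd
  rw [← Nat.factorization_prime_le_iff_dvd hd0 (by positivity)]
  intro p hp
  have h1p := h1 p hp
  rw [show (8 : ℕ) = 2 ^ 3 from rfl]
  rw [Nat.factorization_mul (by positivity) hm0, Nat.factorization_pow, Finsupp.add_apply,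
    Finsupp.smul_apply, Nat.Prime.factorization Nat.prime_two, Finsupp.single_apply] at h1p ⊢
  by_cases hp2 : (2 : ℕ) = p
  · subst hp2
    simp only [if_true, smul_eq_mul, mul_one] at h1p ⊢
    omega
  · simp only [hp2, if_false, smul_eq_mul, mul_zero, zero_add] at h1p ⊢
    exact h1p

/-- **N1c (parity transfer, all primes incl. 2)** `v_p(Δ_min) ≡ v_p(d_K) (mod 2)`; in particular an odd
tower forces `p ∣ d_K` (gen-0 H2) and the squarefree kernel of `Δ_min` is that of `d_K` (gen-0 H3). -/
theorem even_factorization_add (hirr : Irreducible W.twoTorsionPolynomial.toPoly)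
    (hdeg : Module.finrank ℚ K = 3)
    (hθ : ∃ θ : K, Polynomial.aeval θ W.twoTorsionPolynomial.toPoly = 0) (p : ℕ) :
    Even ((W.minimalDiscriminantNorm ℤ).factorization p + (NumberField.discr K).natAbs.factorization p) := by
  obtain ⟨I, hI0, hI⟩ := exists_index_sq_eq W K hirr hdeg hθ
  have hd0 : (NumberField.discr K).natAbs ≠ 0 := Int.natAbs_ne_zero.mpr (NumberField.discr_ne_zero K)
  have hm0 : W.minimalDiscriminantNorm ℤ ≠ 0 := (W.minimalDiscriminantNorm_pos_holds).ne'
  have hIne : I ≠ 0 := hI0.ne'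
  have h := congrArg (fun n : ℕ => n.factorization p) hI
  rw [Nat.factorization_mul (by positivity) hm0, Nat.factorization_mul (pow_ne_zero _ hIne) hd0,
    Nat.factorization_pow, Nat.factorization_pow, Finsupp.add_apply, Finsupp.add_apply,
    Finsupp.smul_apply, Finsupp.smul_apply, smul_eq_mul, smul_eq_mul] at h
  rw [Nat.even_iff]
  omega

/-- **N1♯ (conjectured SHARP 2-adic form)** `|d_K| ∣ 4 · Δ_min`.  Content beyond N1b: `v₂(d_K) = 3`
(`2` wildly ramified, `K ⊗ ℚ₂ ≃ ℚ₂ × ℚ₂(√(2u))`) forces BAD reduction at `2`: with good ordinary reduction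
`ℚ₂(E[2]) = ℚ₂(√u)`, `u ∈ ℤ₂ˣ` (connected–étale sequence of `E[2]/ℤ₂`, `H¹_fl(ℤ₂, μ₂) = ℤ₂ˣ/ℤ₂ˣ²`),
discriminant exponent `≤ 2`; with good supersingular reduction `ℚ₂(E[2]) ⊇` a TAME totally ramified cubic
(`[2]` on the height-2 formal group has three roots of valuation `1/3`), exponent `2`.  Sharp: `11a1`
(`d_K = -44`) and `43a1` (`d_K = -172`) have `2 ∤ Δ_min`.  Certificate: jobs j344444 / j344476 — over the ten
fields with `v₂(d_K) = 3` found by scan (`d_K = 568, 1016, 1384, 1944, 2024, -104, -152, -200, -216, -424`)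
every curve has `v₂(Δ_min) ≥ 1`.  An elementary proof via the Newton polygon of
`t³ + b₂ t² + 8 b₄ t + 16 b₆` and the integrality relation `4 b₈ = b₂ b₆ − b₄²` looks feasible
(case `a₁` odd checked by hand: `b₄` even and `b₆ = 2·odd` contradict `b₈ ∈ ℤ`).  Size M. -/
theorem natAbs_discr_dvd_four_mul (hirr : Irreducible W.twoTorsionPolynomial.toPoly)
    (hdeg : Module.finrank ℚ K = 3)
    (hθ : ∃ θ : K, Polynomial.aeval θ W.twoTorsionPolynomial.toPoly = 0) :
    (NumberField.discr K).natAbs ∣ 4 * W.minimalDiscriminantNorm ℤ := by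
  sorry

/-- **N1♯-loc ("wild ⇒ bad")**, the local content of N1♯: `v₂(d_K) = 3 ⇒ 2 ∣ N`.  (For `v₂(d_K) = 2` the
analogue is FALSE: `11a1`, `N = 11`, `d_K = -44`; compare the odd-prime support lemma
`natAbs_discr_dvd_of_cubic`: `p ≥ 5`, `p ∣ d_K ⇒ p ∣ N`.) -/
theorem two_dvd_conductorNorm_of_factorization_two_eq_three
    (hirr : Irreducible W.twoTorsionPolynomial.toPoly) (hdeg : Module.finrank ℚ K = 3)
    (hθ : ∃ θ : K, Polynomial.aeval θ W.twoTorsionPolynomial.toPoly = 0)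
    (h3 : (NumberField.discr K).natAbs.factorization 2 = 3) :
    2 ∣ W.conductorNorm ℤ := by
  sorry

/-- **L♮ (conjectured sharp conductor law; certificate job j344484: 0 failures on 29 700 curves in 38 cubic fields
covering every wild type `v₂(d_K) = 3`, `v₃(d_K) ∈ {3,4,5}`)** `|d_K| ∣ 4 · N` — versus the landed
`natAbs_discr_dvd_of_cubic : |d_K| ∣ 1944 · N²`.  Prime by prime: `p ≥ 5`: `v_p(d_K) ≤ 2`, `p ∣ d_K ⇒ p ∣ N`
(tree) and `p² ∣ d_K ⇒ p² ∣ N` (gen-0 PB3); `p = 3`: `v₃(d_K) = f₃(E[2]) ≤ f₃(E)` (conductor–discriminant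
formula for the `S₃`-representation `E[2]`, Swan parts agree; observed: EQUALITY `v₃(N) = v₃(d_K)` on 100 % of
the curves of the four wild-at-3 fields); `p = 2`: cap `v₂(d_K) ≤ 3` + N1♯-loc.  Sharp: `11a1`, `d_K = -44 = -4·N`.
Consequence: the crux's allowance is `≤ 4N`, so `IndexSzpiro ⇒ Δ_min ≤ 4C·N^{7+ε}` on the irreducible-`ψ₂` class. -/
theorem natAbs_discr_dvd_four_mul_conductorNorm (hirr : Irreducible W.twoTorsionPolynomial.toPoly)
    (hdeg : Module.finrank ℚ K = 3)
    (hθ : ∃ θ : K, Polynomial.aeval θ W.twoTorsionPolynomial.toPoly = 0) :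
    (NumberField.discr K).natAbs ∣ 4 * W.conductorNorm ℤ := by
  sorry

end Identity

/-! ## The stub in index language: `StubRealCubic ↔ IndexBound` (proved both ways, modulo N1★) -/

/-- **IndexBound**: on the real irreducible class, the index `I` of N1★ satisfies `I² ≤ C · N^{6+ε}`. -/
def IndexBound : Prop :=
  ∀ ε : ℝ, 0 < ε → ∃ C : ℝ, ∀ (W : WeierstrassCurve ℚ) [W.IsElliptic] (K : Type) [Field K]
    [NumberField K], Irreducible W.twoTorsionPolynomial.toPoly → Module.finrank ℚ K = 3 →
    (∃ θ : K, Polynomial.aeval θ W.twoTorsionPolynomial.toPoly = 0) → 0 < NumberField.discr K →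
    ∀ I : ℕ, 2 ^ 8 * W.minimalDiscriminantNorm ℤ = I ^ 2 * (NumberField.discr K).natAbs →
      (I : ℝ) ^ 2 ≤ C * (W.conductorNorm ℤ : ℝ) ^ (6 + ε)

private theorem cast_identity {W : WeierstrassCurve ℚ} {K : Type} [Field K] [NumberField K] {I : ℕ}
    (hI : 2 ^ 8 * W.minimalDiscriminantNorm ℤ = I ^ 2 * (NumberField.discr K).natAbs) :
    (2 : ℝ) ^ 8 * (W.minimalDiscriminantNorm ℤ : ℝ) = (I : ℝ) ^ 2 * |(NumberField.discr K : ℝ)| := by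
  have h := congrArg (fun n : ℕ => (n : ℝ)) hI
  simp only [Nat.cast_mul, Nat.cast_pow, Nat.cast_ofNat, Nat.cast_natAbs, Int.cast_abs] at h
  exact h

/-- `IndexBound ⇒ stub_realCubic` with constant `C / 2⁸`. -/
theorem stubRealCubic_of_indexBound (h : IndexBound) : StubRealCubic := by
  intro ε hε
  obtain ⟨C, hC⟩ := h ε hε
  refine ⟨C / 2 ^ 8, ?_⟩
  intro W _ K _ _ hirr hdeg hθ hpos
  obtain ⟨I, -, hI⟩ := exists_index_sq_eq W K hirr hdeg hθ
  have hb := hC W K hirr hdeg hθ hpos I hI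
  have hR := cast_identity hI
  have hd : 0 ≤ |(NumberField.discr K : ℝ)| := abs_nonneg _
  have key : (I : ℝ) ^ 2 * |(NumberField.discr K : ℝ)| ≤
      C * (W.conductorNorm ℤ : ℝ) ^ (6 + ε) * |(NumberField.discr K : ℝ)| :=
    mul_le_mul_of_nonneg_right hb hd
  calc (W.minimalDiscriminantNorm ℤ : ℝ)
        = (I : ℝ) ^ 2 * |(NumberField.discr K : ℝ)| / 2 ^ 8 := by rw [← hR]; ring
    _ ≤ C * (W.conductorNorm ℤ : ℝ) ^ (6 + ε) * |(NumberField.discr K : ℝ)| / 2 ^ 8 :=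
        div_le_div_of_nonneg_right key (by positivity)
    _ = C / 2 ^ 8 * |(NumberField.discr K : ℝ)| * (W.conductorNorm ℤ : ℝ) ^ (6 + ε) := by ring

/-- `stub_realCubic ⇒ IndexBound` with constant `2⁸ · C` (so the stub IS index-Szpiro). -/
theorem indexBound_of_stubRealCubic (h : StubRealCubic) : IndexBound := by
  intro ε hε
  obtain ⟨C, hC⟩ := h ε hε
  refine ⟨2 ^ 8 * C, ?_⟩
  intro W _ K _ _ hirr hdeg hθ hpos I hI
  have hb := hC W K hirr hdeg hθ hpos
  have hR := cast_identity hI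
  have hd : 0 < |(NumberField.discr K : ℝ)| := by
    rw [abs_pos]; exact_mod_cast (NumberField.discr_ne_zero K)
  have key : (I : ℝ) ^ 2 * |(NumberField.discr K : ℝ)| ≤
      2 ^ 8 * C * (W.conductorNorm ℤ : ℝ) ^ (6 + ε) * |(NumberField.discr K : ℝ)| := by
    rw [← hR]; nlinarith [hb]
  exact le_of_mul_le_mul_right key hd

/-! ## Plan D — the universal plane-cubic family `curveOf α`, `α ∈ 𝓞_K` (Delone–Faddeev / twisted-`X(2)` dictionary) -/

section Family

variable (K : Type) [Field K] [NumberField K]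

/-- The plane cubic `y² = f_α(x)`, `f_α = minpoly_ℤ α`, attached to an algebraic integer `α ∈ 𝓞_K`
(`⟨a₁, a₂, a₃, a₄, a₆⟩ = ⟨0, c₂, 0, c₁, c₀⟩` for `f_α = X³ + c₂ X² + c₁ X + c₀`).  For
`α = u·w₁ + v·w₂` this is the job's curve `E_{u,v}`; its 2-division field contains `K`. -/
def curveOf (α : 𝓞 K) : WeierstrassCurve ℤ :=
  ⟨0, (minpoly ℤ α).coeff 2, 0, (minpoly ℤ α).coeff 1, (minpoly ℤ α).coeff 0⟩

/-- **Dα1** `ψ₂(E_α) = 4·f_α` when `α` generates `K` (`a₁ = a₃ = 0`: `b₂ = 4a₂`, `b₄ = 2a₄`, `b₆ = 4a₆`). -/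
theorem twoTorsionPolynomial_curveOf (α : 𝓞 K) (hα : (minpoly ℤ α).natDegree = 3) :
    (curveOf K α).twoTorsionPolynomial.toPoly = 4 * minpoly ℤ α := by
  sorry

/-- **Dα2** `Δ(E_α) = 16 · disc(f_α) = 16 · I(α)² · d_K`, `I(α) = det` of `(1, α, α²)` in an integral
basis (= the index `[𝓞_K : ℤ[α]]` up to sign): Mathlib `twoTorsionPolynomial_discr` + Dα1 for
`Δ = 16 disc f_α`, the power basis for `disc f_α = discr ℚ (1, α, α²)`, and the tree lemma
`discr_family_eq_det_sq_mul_discr`.  This is the integral, family-level form of N1★. -/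
theorem Δ_curveOf_eq (e : Module.Free.ChooseBasisIndex ℤ (𝓞 K) ≃ Fin 3) (α : 𝓞 K)
    (hα : (minpoly ℤ α).natDegree = 3) :
    ((curveOf K α).Δ : ℚ) =
      16 * ((((RingOfIntegers.basis K).reindex e).det (fun i : Fin 3 => α ^ (i : ℕ)) : ℤ) : ℚ) ^ 2 *
        NumberField.discr K := by
  sorry

/-- **Dα3 (odd unramified index primes are multiplicative)** for `α` primitive at `p` (`α ∉ ℤ + p𝓞_K`),
`p` odd, `p ∤ d_K`, `p ∣ Δ(E_α)`: `f_α mod p` has a double but not a triple root, so `p ∤ c₄`, the model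
is minimal at `p` with multiplicative reduction and `p ‖ N` (Tate; pattern of
`TwoTorsionDictionary.dvd_conductorNorm_of_odd_prime`, `isMinimalAt_baseChange_int_of_not_dvd_c₄`,
`conductorExponent_eq_one_of_dvd_Δ_of_not_dvd_c₄`).  Consequence: after twist-normalisation every
curve of the class is SEMISTABLE AWAY FROM `2·d_K`. -/
theorem dvd_conductorNorm_of_dvd_Δ_curveOf (α : 𝓞 K) (hα : (minpoly ℤ α).natDegree = 3)
    [((curveOf K α).baseChange ℚ).IsElliptic] {p : ℕ} (hp : p.Prime) (hp2 : p ≠ 2)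
    (hpd : ¬ (p : ℤ) ∣ NumberField.discr K) (hprim : ∀ c : ℤ, ¬ ((p : 𝓞 K) ∣ α - (c : 𝓞 K)))
    (hpΔ : (p : ℤ) ∣ (curveOf K α).Δ) :
    p ∣ ((curveOf K α).baseChange ℚ).conductorNorm ℤ ∧
      ¬ p ^ 2 ∣ ((curveOf K α).baseChange ℚ).conductorNorm ℤ := by
  sorry

/-- **Dα4 (universality)** every curve of the class is `ℚ`-isomorphic to some `E_α`, `α ∈ 𝓞_K` a
generator: complete the square and rescale `(x, y) ↦ (x/4, y/8)`, i.e. `W ≅ ⟨0, b₂, 0, 8b₄, 16b₆⟩ = E_{θ'}`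
with `θ' = 4·x(P)` (applied to an integral model). -/
theorem exists_variableChange_eq_curveOf (W : WeierstrassCurve ℚ) [W.IsElliptic]
    (hirr : Irreducible W.twoTorsionPolynomial.toPoly) (hdeg : Module.finrank ℚ K = 3)
    (hθ : ∃ θ : K, Polynomial.aeval θ W.twoTorsionPolynomial.toPoly = 0) :
    ∃ α : 𝓞 K, (minpoly ℤ α).natDegree = 3 ∧
      ∃ C : WeierstrassCurve.VariableChange ℚ, C • W = (curveOf K α).baseChange ℚ := by
  sorry

/-- **Dα4′ (universality at the minimal model)**: choosing the global minimal model in Dα4 gives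
`|Δ(E_α)| = 2⁸ · Δ_min` — with Dα2 this is N1★ with `I = |det|`. -/
theorem exists_variableChange_eq_curveOf_Δ (W : WeierstrassCurve ℚ) [W.IsElliptic]
    (hirr : Irreducible W.twoTorsionPolynomial.toPoly) (hdeg : Module.finrank ℚ K = 3)
    (hθ : ∃ θ : K, Polynomial.aeval θ W.twoTorsionPolynomial.toPoly = 0) :
    ∃ α : 𝓞 K, (minpoly ℤ α).natDegree = 3 ∧
      (∃ C : WeierstrassCurve.VariableChange ℚ, C • W = (curveOf K α).baseChange ℚ) ∧
      (curveOf K α).Δ.natAbs = 2 ^ 8 * W.minimalDiscriminantNorm ℤ := by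
  sorry

/-- **Dα5 (primitive reduction = quadratic twist)** `α = p·β + c` ⇒ `E_α ≅ (E_β)^{(p)}` over `ℚ`
(`f_α(x + c) = p³ f_β(x/p)`; `WeierstrassCurve.quadraticTwist`).  So the class is the set of quadratic
twists of the PRIMITIVE family, and Szpiro-type bounds transfer along twists (k1's twist-transfer
lemmas / `stub_twistTransferOdd` pattern). -/
theorem exists_variableChange_curveOf_eq_quadraticTwist (α β : 𝓞 K) (p : ℕ) (c : ℤ)
    (hβ : (minpoly ℤ β).natDegree = 3) (h : α = (p : 𝓞 K) * β + (c : 𝓞 K)) (hp : p ≠ 0) :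
    ∃ C : WeierstrassCurve.VariableChange ℚ,
      C • (curveOf K α).baseChange ℚ = ((curveOf K β).baseChange ℚ).quadraticTwist (p : ℚ) := by
  sorry

end Family

/-! ## The one-field slice (family 3 extreme: fix `K`, let the towers grow) -/

/-- **FixedFieldIndexSzpiro K**: the stub restricted to ONE cubic field `K`, constant allowed to depend
on `K` (so the allowance `|d_K|` is absorbed).  Formally weaker than the stub; numerically still
summit-like: job j344421 finds `Δ_min / (|d_K| N⁶) = e^{26.6}` (`σ = 7.44`) inside `d_K = 564` and
j344431 `σ = 7.45` inside `d_K = 568` (single `p`-adic towers `u ≡ r·v (mod p^k)` of the index form),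
and the slice is abc for ONE binary cubic (index) form — open even for `d_K = 49`. -/
def FixedFieldIndexSzpiro (K : Type) [Field K] [NumberField K] : Prop :=
  ∀ ε : ℝ, 0 < ε → ∃ C : ℝ, ∀ (W : WeierstrassCurve ℚ) [W.IsElliptic],
    Irreducible W.twoTorsionPolynomial.toPoly →
    (∃ θ : K, Polynomial.aeval θ W.twoTorsionPolynomial.toPoly = 0) →
    (W.minimalDiscriminantNorm ℤ : ℝ) ≤ C * (W.conductorNorm ℤ : ℝ) ^ (6 + ε)

/-- The stub gives every real cubic slice (constant `C · |d_K|`). -/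
theorem fixedField_of_stubRealCubic (h : StubRealCubic) (K : Type) [Field K] [NumberField K]
    (hdeg : Module.finrank ℚ K = 3) (hpos : 0 < NumberField.discr K) : FixedFieldIndexSzpiro K := by
  intro ε hε
  obtain ⟨C, hC⟩ := h ε hε
  exact ⟨C * |(NumberField.discr K : ℝ)|, fun W _ hirr hθ => hC W K hirr hdeg hθ hpos⟩

end Summit.ABC.ABC.Cruxes.IndexSzpiro.StubIdeas3G2
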